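import Literature.Computability.Cryptography.PseudorandomGeneratorsAnyOWF
import Literature.Computability.MetaComplexity.DistProblems
import Literature.Probability.LatticeModels.IndependencePolynomial
import Literature.Computability.Complexity.AOWProgramFP
import Literature.Computability.Complexity.CNFInvariance

/-!
# Shape uniformiser: disjoint duplication and padding of E3-CNFs
(stub `stub_dupPad` of line `prg-image-exact-threshold-lift`, crux stmt-PneNP-2721, step S2b)

Given an exponent `a`, the map `(φ, y) ↦ DupPad.dupPad a φ |y|` takes `k = ⌈M / |φ|⌉` variable-disjoint
copies of `φ` (`M = (|y| + 2)^a + |y|`; copy `i` renames `v ↦ 2 (v k + i)`) and pads with fresh positive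
clauses on odd variables up to EXACTLY `m |y| = 2 M + 1` clauses (`DupPad.length_dupPad`). It keeps exact
width `3` (`isExactWidth_dupPad`), variable occurrences up to `max B 1` (`countP_dupPad_le`), satisfiability
(`satisfiable_dupPad`) and a value gap up to the factor `κ = 1/3` (`maxSatFraction_dupPad_le`: every
assignment violates `≥ γ k |φ| ≥ γ M ≥ γ m / 3` clauses), and it is computed on codes (`encodingCNF`,
`boolPair`; the typed codes `AOWProg.cnfE = encodingCNF.encode` of `AOWProgramFP.lean`) by an `FP` string function
assembled from the typed combinators of `CodeFP.lean` (`dupPad_codeFP`). Everything used is proved in the tree.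
-/

set_option linter.dupNamespace false -- `Summit.PneNP.PneNP.…`: summit = sub-problem (D-0017)

namespace Summit.PneNP.PneNP.Theorems

open Filter
open Literature.Computability.Complexity Literature.Computability.MetaComplexity
open Literature.Computability.Cryptography (OWFExist PRGExist IsPRG IsCompIndistinguishable uniformBits
  PRGExist_of_OWFExist)
open Literature.Probability.LatticeModels (hardCoreThreshold)
open _root_.Computability

namespace DupPad

open CodeFP

/-! ### The construction -/

/-- The budget `M = (ℓ + 2)^a + ℓ` (a bound on the clause count, plus `ℓ` for strict monotonicity). -/
def MOf (a ℓ : ℕ) : ℕ := (ℓ + 2) ^ a + ℓ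

/-- The uniform clause count `m ℓ = 2 M + 1`. -/
def mOf (a ℓ : ℕ) : ℕ := 2 * MOf a ℓ + 1

/-- The number of copies `k = ⌈M / c⌉`, capped by `M` (`0` when `c = 0`, by `n / 0 = 0`). -/
def kOf (M c : ℕ) : ℕ := min ((M + c - 1) / c) M

/-- The renaming of copy `i` out of `k`: `v ↦ 2 (v k + i)` (even variables). -/
def ren (k i v : ℕ) : ℕ := 2 * (v * k + i)

/-- Padding clause `j`: three positive literals on the fresh odd variables `6j+1, 6j+3, 6j+5`. -/
def padClause (j : ℕ) : Clause ℕ :=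
  [(2 * (3 * j) + 1, true), (2 * (3 * j + 1) + 1, true), (2 * (3 * j + 2) + 1, true)]

/-- The `k` variable-disjoint copies of `φ`. -/
def copies (φ : CNF ℕ) (k : ℕ) : CNF ℕ := ((List.range k).map fun i => φ.rename (ren k i)).flatten

/-- **The output formula**: `k = kOf M |φ|` disjoint copies of `φ`, padded to exactly `m ℓ` clauses. -/
def dupPad (a : ℕ) (φ : CNF ℕ) (ℓ : ℕ) : CNF ℕ :=
  copies φ (kOf (MOf a ℓ) φ.length) ++ (List.range (mOf a ℓ - kOf (MOf a ℓ) φ.length * φ.length)).map padClause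

/-! ### Arithmetic of the parameters -/

/-- `M ≥ 1`. -/
theorem MOf_pos (a ℓ : ℕ) : 0 < MOf a ℓ := by
  unfold MOf; have := Nat.one_le_pow a (ℓ + 2) (by omega); omega

/-- `m` is strictly monotone. -/
theorem mOf_strictMono (a : ℕ) : StrictMono (mOf a) := by
  refine strictMono_nat_of_lt_succ fun ℓ => ?_
  unfold mOf MOf
  have := Nat.pow_le_pow_left (show ℓ + 2 ≤ ℓ + 1 + 2 by omega) a
  omega

/-- `m ≥ 1`. -/
theorem mOf_pos (a ℓ : ℕ) : 0 < mOf a ℓ := by unfold mOf; omega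

/-- `k c ≤ M + c - 1`. -/
theorem kOf_mul_le (M c : ℕ) : kOf M c * c ≤ M + c - 1 :=
  (Nat.mul_le_mul_right c (min_le_left _ _)).trans (Nat.div_mul_le_self _ _)

/-- `M ≤ k c` for `c ≥ 1`. -/
theorem le_kOf_mul {M c : ℕ} (hc : 0 < c) : M ≤ kOf M c * c := by
  unfold kOf
  rcases min_cases ((M + c - 1) / c) M with ⟨h, -⟩ | ⟨h, -⟩
  · rw [h]; have := Nat.lt_div_mul_add (a := M + c - 1) hc; omega
  · rw [h]; exact Nat.le_mul_of_pos_right M hc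

/-- The variables of a renamed clause: `v` occurs in copy `i < k` iff `v` is even, `v / 2 ≡ i (mod k)` and
`v / 2 / k` occurs in the original clause. -/
theorem mem_map_rename_iff {k i : ℕ} (hi : i < k) (cl : Clause ℕ) (v : ℕ) :
    v ∈ (cl.map (CookLevin.renLit (ren k i))).map Prod.fst ↔ v % 2 = 0 ∧ v / 2 % k = i ∧ v / 2 / k ∈ cl.map Prod.fst := by
  simp only [List.map_map, List.mem_map, Function.comp_apply, CookLevin.renLit, ren]
  constructor
  · rintro ⟨l, hl, rfl⟩
    rw [show 2 * (l.1 * k + i) / 2 = i + l.1 * k by omega, Nat.add_mul_mod_self_right, Nat.mod_eq_of_lt hi,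
      Nat.add_mul_div_right _ _ (by omega), Nat.div_eq_of_lt hi, zero_add]
    exact ⟨by omega, rfl, l, hl, rfl⟩
  · rintro ⟨h2, hmod, l, hl, hl1⟩
    refine ⟨l, hl, ?_⟩
    have := Nat.div_add_mod' (v / 2) k
    rw [hl1, ← hmod, this]
    omega

/-! ### Shape: exact clause count and exact width -/

/-- **Exact clause count**: `|dupPad a φ ℓ| = m ℓ` whenever `|φ| ≤ (ℓ + 2)^a` (each copy has `|φ|` clauses). -/
theorem length_dupPad (a : ℕ) {φ : CNF ℕ} {ℓ : ℕ} (h : φ.length ≤ (ℓ + 2) ^ a) : (dupPad a φ ℓ).length = mOf a ℓ := by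
  have hc : (copies φ (kOf (MOf a ℓ) φ.length)).length = kOf (MOf a ℓ) φ.length * φ.length := by
    rw [copies, List.length_flatten, List.map_map]
    have : (List.length ∘ fun i => φ.rename (ren (kOf (MOf a ℓ) φ.length) i)) = fun _ => φ.length := by
      funext i; simp [CNF.rename]
    rw [this, List.map_const', List.sum_replicate_nat, List.length_range]
  rw [dupPad, List.length_append, hc, List.length_map, List.length_range, mOf]
  have h1 := kOf_mul_le (MOf a ℓ) φ.length
  have h2 : φ.length ≤ MOf a ℓ := h.trans (Nat.le_add_right _ _)
  generalize kOf (MOf a ℓ) φ.length * φ.length = K at h1 ⊢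
  omega

/-- **Exact width `3` is kept** (copies: injective renamings; padding: three distinct variables). -/
theorem isExactWidth_dupPad (a : ℕ) {φ : CNF ℕ} (h3 : φ.IsExactWidth 3) (ℓ : ℕ) : (dupPad a φ ℓ).IsExactWidth 3 := by
  intro cl hcl
  unfold dupPad copies at hcl
  rcases List.mem_append.1 hcl with h | h
  · obtain ⟨L, hL, hclL⟩ := List.mem_flatten.1 h
    obtain ⟨i, hi, rfl⟩ := List.mem_map.1 hL
    have hk : 0 < kOf (MOf a ℓ) φ.length := by have := List.mem_range.1 hi; omega
    refine φ.isExactWidth_rename (fun v _ w _ hvw => ?_) h3 cl hclL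
    unfold ren at hvw
    exact Nat.eq_of_mul_eq_mul_right hk (by omega)
  · obtain ⟨j, -, rfl⟩ := List.mem_map.1 h
    refine ⟨rfl, ?_⟩
    simp only [padClause, List.map_cons, List.map_nil, List.nodup_cons, List.mem_cons, List.not_mem_nil,
      List.nodup_nil, or_false, not_or, and_true, not_false_eq_true]
    omega

/-! ### Variable occurrences -/

/-- A sum over `[0, k)` all of whose terms but the `j`-th vanish is at most that term. -/
theorem sum_map_range_le_single {f : ℕ → ℕ} {j : ℕ} :
    ∀ {k : ℕ}, (∀ i < k, i ≠ j → f i = 0) → ((List.range k).map f).sum ≤ f j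
  | 0, _ => by simp
  | k + 1, h => by
    rw [List.range_succ, List.map_append, List.sum_append, List.map_singleton, List.sum_singleton]
    have ih := sum_map_range_le_single (k := k) fun i hi hij => h i (by omega) hij
    by_cases hkj : k = j
    · subst hkj
      have h0 : ((List.range k).map f).sum = 0 := List.sum_eq_zero fun x hx => by
        obtain ⟨i, hi, rfl⟩ := List.mem_map.1 hx
        have := List.mem_range.1 hi
        exact h i (by omega) (by omega)
      omega
    · rw [h k (by omega) hkj]; omega

/-- Occurrences in the copies: none for odd `v`; for even `v` only copy `v / 2 % k` contributes, as often as
the original variable `v / 2 / k` occurs in `φ`. -/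
theorem countP_copies_le (φ : CNF ℕ) (k v : ℕ) : ((copies φ k).countP fun cl => v ∈ cl.map Prod.fst) ≤
    if v % 2 = 0 then φ.countP fun cl => v / 2 / k ∈ cl.map Prod.fst else 0 := by
  rcases Nat.eq_zero_or_pos k with rfl | hk
  · simp [copies]
  rw [copies, List.countP_flatten, List.map_map]
  refine (sum_map_range_le_single (j := v / 2 % k) fun i hi hij => ?_).trans ?_
  · simp only [Function.comp_apply, CNF.rename, List.countP_map]
    refine List.countP_eq_zero.2 fun cl _ => ?_
    simp only [Function.comp_apply, decide_eq_true_eq, mem_map_rename_iff hi]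
    omega
  · simp only [Function.comp_apply, CNF.rename, List.countP_map]
    split_ifs with hv
    · refine List.countP_mono_left fun cl _ => ?_
      simp only [Function.comp_apply, decide_eq_true_eq, mem_map_rename_iff (Nat.mod_lt _ hk)]
      exact fun h => h.2.2
    · refine Nat.le_zero.2 (List.countP_eq_zero.2 fun cl _ => ?_)
      simp only [Function.comp_apply, decide_eq_true_eq, mem_map_rename_iff (Nat.mod_lt _ hk)]
      omega

/-- Occurrences in the padding: none for even `v`, at most one (clause `v / 6`) for odd `v`. -/
theorem countP_pad_le (n v : ℕ) :
    (((List.range n).map padClause).countP fun cl => v ∈ cl.map Prod.fst) ≤ if v % 2 = 0 then 0 else 1 := by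
  rw [List.countP_map]
  split_ifs with hv
  · refine Nat.le_zero.2 (List.countP_eq_zero.2 fun j _ => ?_)
    simp [padClause]
    omega
  · calc List.countP ((fun cl : Clause ℕ => decide (v ∈ cl.map Prod.fst)) ∘ padClause) (List.range n)
        ≤ (List.range n).count (v / 2 / 3) := by
          rw [List.count_eq_countP]
          refine List.countP_mono_left fun j _ h => ?_
          simp [padClause] at h
          simp only [beq_iff_eq]
          omega
      _ ≤ 1 := List.nodup_iff_count_le_one.1 List.nodup_range _

/-- **Occurrence bounds are kept** (up to `max B 1`). -/
theorem countP_dupPad_le (a : ℕ) {φ : CNF ℕ} {B : ℕ} (hB : ∀ v : ℕ, (φ.countP fun cl => v ∈ cl.map Prod.fst) ≤ B)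
    (ℓ v : ℕ) : ((dupPad a φ ℓ).countP fun cl => v ∈ cl.map Prod.fst) ≤ max B 1 := by
  rw [dupPad, List.countP_append]
  have h1 := countP_copies_le φ (kOf (MOf a ℓ) φ.length) v
  have h2 := countP_pad_le (mOf a ℓ - kOf (MOf a ℓ) φ.length * φ.length) v
  split_ifs at h1 h2 with hv
  · have := hB (v / 2 / kOf (MOf a ℓ) φ.length); omega
  · omega

/-! ### Satisfiability and the value gap -/

/-- **Satisfiability is kept**: copy `i` reads `σ` through `v ↦ v / 2 / k`; padding variables are `true`. -/
theorem satisfiable_dupPad (a : ℕ) {φ : CNF ℕ} (h : φ.Satisfiable) (ℓ : ℕ) : (dupPad a φ ℓ).Satisfiable := by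
  obtain ⟨σ, hσ⟩ := h
  set k := kOf (MOf a ℓ) φ.length with hk
  refine ⟨fun x => if x % 2 = 0 then σ (x / 2 / k) else true, (CNF.eval_eq_true_iff _ _).2 fun cl hcl => ?_⟩
  unfold dupPad copies at hcl
  rcases List.mem_append.1 hcl with h | h
  · obtain ⟨L, hL, hclL⟩ := List.mem_flatten.1 h
    obtain ⟨i, hi, rfl⟩ := List.mem_map.1 hL
    have hik : i < k := List.mem_range.1 hi
    refine (CNF.eval_eq_true_iff _ _).1 ?_ cl hclL
    rw [CNF.eval_rename, ← hσ]
    congr 1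
    funext v
    simp only [Function.comp_apply, ren, Nat.mul_mod_right, ↓reduceIte]
    rw [show 2 * (v * k + i) / 2 = i + v * k by omega, Nat.add_mul_div_right _ _ (by omega), Nat.div_eq_of_lt hik,
      zero_add]
  · obtain ⟨j, -, rfl⟩ := List.mem_map.1 h
    simp [padClause, Clause.eval, Literal.eval]

/-- At most `val(φ) · |φ|` clauses of a nonempty `φ` are satisfied by any assignment. -/
theorem cast_countP_eval_le {φ : CNF ℕ} (hφ : φ ≠ []) (σ : ℕ → Bool) :
    ((φ.countP fun c => c.eval σ : ℕ) : ℚ) ≤ φ.maxSatFraction * φ.length := by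
  have h := φ.satisfiedFraction_le_maxSatFraction σ
  rwa [CNF.satisfiedFraction, CNF.numClauses, if_neg (List.length_pos_of_ne_nil hφ).ne',
    div_le_iff₀ (by exact_mod_cast List.length_pos_of_ne_nil hφ)] at h

/-- Satisfied clauses of a concatenation of formulas each obeying the same bound. -/
theorem cast_countP_flatten_le {p : Clause ℕ → Bool} {X : ℚ} :
    ∀ L : List (CNF ℕ), (∀ θ ∈ L, ((θ.countP p : ℕ) : ℚ) ≤ X) → ((L.flatten.countP p : ℕ) : ℚ) ≤ L.length * X
  | [], _ => by simp
  | θ :: L, h => by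
    rw [List.flatten_cons, List.countP_append, Nat.cast_add, List.length_cons, Nat.cast_succ]
    have h1 := h θ List.mem_cons_self
    have h2 := cast_countP_flatten_le L fun θ' h' => h θ' (List.mem_cons_of_mem _ h')
    linarith

/-- **The value gap is kept up to the factor `1/3`**: if `val(φ) ≤ 1 - γ` then every assignment violates
`≥ γ |φ|` clauses of each of the `k` copies, `k |φ| ≥ M`, and `M / m ≥ 1/3`. -/
theorem maxSatFraction_dupPad_le (a : ℕ) {φ : CNF ℕ} {ℓ : ℕ} (hlen : φ.length ≤ (ℓ + 2) ^ a) {γ : ℚ}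
    (hval : φ.maxSatFraction ≤ 1 - γ) : (dupPad a φ ℓ).maxSatFraction ≤ 1 - 1 / 3 * γ := by
  rw [CNF.maxSatFraction_le_iff]
  intro σ
  rcases le_or_gt γ 0 with hγ | hγ
  · exact (CNF.satisfiedFraction_le_one _ σ).trans (by linarith)
  have hφ : φ ≠ [] := by rintro rfl; rw [CNF.maxSatFraction_nil] at hval; linarith
  have hc : 0 < φ.length := List.length_pos_of_ne_nil hφ
  set M := MOf a ℓ with hM
  set k := kOf M φ.length with hk
  set m := mOf a ℓ with hm
  have hkc : (M : ℚ) ≤ k * φ.length := by exact_mod_cast le_kOf_mul hc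
  have hkcm : k * φ.length ≤ m := by
    have h1 := kOf_mul_le M φ.length
    have h2 : φ.length ≤ M := hlen.trans (Nat.le_add_right _ _)
    rw [hm, mOf, ← hM]; rw [← hk] at h1
    generalize k * φ.length = K at h1 ⊢; omega
  -- the satisfied clauses: `≤ (1 - γ) |φ|` in each copy, `≤ m - k |φ|` in the padding
  have hcop : (((copies φ k).countP fun c => c.eval σ : ℕ) : ℚ) ≤ k * (φ.length - γ * φ.length) := by
    have h := cast_countP_flatten_le (p := fun c => c.eval σ) (X := φ.length - γ * φ.length)
      ((List.range k).map fun i => φ.rename (ren k i)) fun θ hθ => by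
        obtain ⟨i, -, rfl⟩ := List.mem_map.1 hθ
        have h1 : (((φ.rename (ren k i)).countP fun c => c.eval σ : ℕ) : ℚ) =
            ((φ.countP fun c => c.eval (σ ∘ ren k i) : ℕ) : ℚ) := by
          rw [CNF.rename, List.countP_map]
          congr 2; funext c; exact CNF.clause_eval_renLit (ren k i) c σ
        rw [h1]
        have h2 := cast_countP_eval_le hφ (σ ∘ ren k i)
        have h3 : (0 : ℚ) ≤ φ.length := by positivity
        nlinarith
    rwa [List.length_map, List.length_range] at h
  have hpad : (((List.range (m - k * φ.length)).map padClause).countP fun c => c.eval σ : ℕ) + k * φ.length ≤ m := by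
    have := (List.countP_le_length (p := fun c => c.eval σ) (l := (List.range (m - k * φ.length)).map padClause))
    rw [List.length_map, List.length_range] at this
    generalize k * φ.length = K at this hkcm ⊢; omega
  have hpadQ := (Nat.cast_le (α := ℚ)).2 hpad
  push_cast at hpadQ
  -- conclude
  have hmpos : (0 : ℚ) < m := by exact_mod_cast mOf_pos a ℓ
  have h3M : (m : ℚ) ≤ 3 * M := by
    rw [hm, mOf, ← hM]; push_cast
    have : (1 : ℚ) ≤ M := by exact_mod_cast MOf_pos a ℓ
    linarith
  have hsplit : ((dupPad a φ ℓ).countP fun c => c.eval σ) = ((copies φ k).countP fun c => c.eval σ) +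
      (((List.range (m - k * φ.length)).map padClause).countP fun c => c.eval σ) := by rw [dupPad, List.countP_append]
  rw [CNF.satisfiedFraction, CNF.numClauses, length_dupPad a hlen, if_neg (mOf_pos a ℓ).ne', div_le_iff₀ hmpos, hsplit,
    Nat.cast_add]
  nlinarith [mul_le_mul_of_nonneg_left h3M hγ.le, mul_le_mul_of_nonneg_left hkc hγ.le]

/-! ### The program
Codes: `litE = pairE natE bitE`, `cnfE = listE (listE litE) = encodingCNF.encode` (`AOWProgramFP.lean`). -/

open AOWProg (litE cnfE)

/-- The input code `⟨code φ, y⟩` (`strE = id`). -/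
abbrev inE : CNF ℕ × List Bool → List Bool := pairE cnfE strE

/-- The literal renaming of copy `i` out of `k`, on codes: `((k, i), l) ↦ (2 (l.1 k + i), l.2)`. -/
theorem renLitFP : CodeFP (pairE (pairE natE natE) litE) litE (fun t => CookLevin.renLit (ren t.1.1 t.1.2) t.2) := by
  have hk : CodeFP (pairE (pairE natE natE) litE) natE (fun t => t.1.1) := (fst _ _).fst'
  have hi : CodeFP (pairE (pairE natE natE) litE) natE (fun t => t.1.2) := (fst _ _).snd'
  have hv : CodeFP (pairE (pairE natE natE) litE) natE (fun t => t.2.1) := (snd _ _).fst'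
  have hr : CodeFP (pairE (pairE natE natE) litE) natE (fun t => 2 * (t.2.1 * t.1.1 + t.1.2)) :=
    (natMul.comp ((const _ 2).pair (natAdd.comp ((natMul.comp (hv.pair hk)).pair hi)))).congr fun _ => rfl
  exact (hr.pair (snd _ _).snd').congr fun _ => rfl

/-- The copies, on codes: `((φ, k), idx) ↦ (idx.map fun i => φ.rename (ren k i)).flatten` (two nested `map`s). -/
theorem copiesFP : CodeFP (pairE (pairE (rawE (rawE litE)) natE) (rawE natE)) (rawE (rawE litE))
    (fun t => (t.2.map fun i => CNF.rename (ren t.1.2 i) t.1.1).flatten) := by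
  have hcl : CodeFP (pairE (pairE natE natE) (rawE litE)) (rawE litE)
      (fun t => t.2.map (CookLevin.renLit (ren t.1.1 t.1.2))) := (map renLitFP).congr fun _ => rfl
  have hctx : CodeFP (pairE (pairE (rawE (rawE litE)) natE) natE) (pairE (pairE natE natE) (rawE (rawE litE)))
      (fun t => ((t.1.2, t.2), t.1.1)) := (((fst _ _).snd').pair (snd _ _)).pair ((fst _ _).fst')
  have hcopy : CodeFP (pairE (pairE (rawE (rawE litE)) natE) natE) (rawE (rawE litE))
      (fun t => CNF.rename (ren t.1.2 t.2) t.1.1) := ((map hcl).comp hctx).congr fun _ => rfl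
  exact ((flatten (rawE litE)).comp (map hcopy)).congr fun _ => rfl

/-- A padding literal `(2 (3 j + r) + 1, true)` on codes. -/
theorem padLitFP (r : ℕ) : CodeFP natE litE (fun j => (2 * (3 * j + r) + 1, true)) := by
  have h : CodeFP natE natE (fun j => 2 * (3 * j + r) + 1) :=
    (natAdd.comp ((natMul.comp ((const _ 2).pair (natAdd.comp ((natMul.comp ((const _ 3).pair
      (CodeFP.id natE))).pair (const _ r))))).pair (const _ 1))).congr fun _ => rfl
  exact (h.pair (const natE true)).congr fun _ => rfl

/-- The padding clause on codes. -/
theorem padClauseFP : CodeFP natE (rawE litE) padClause := by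
  have h0 : CodeFP natE (rawE litE) (fun _ => ([] : Clause ℕ)) := const _ _
  exact ((rawCons litE).comp ((padLitFP 0).pair ((rawCons litE).comp ((padLitFP 1).pair
    ((rawCons litE).comp ((padLitFP 2).pair h0)))))).congr fun _ => rfl

/-- **`dupPad` is computed on codes by a polynomial-time string function** (typed `CodeFP` combinators: the
parameters in unary through the unit budget `unitsPow a`, the loops as `map`s over `urange`s). -/
theorem dupPad_codeFP (a : ℕ) : CodeFP (pairE cnfE strE) cnfE (fun p => dupPad a p.1 p.2.length) := by
  -- the inputs: raw clauses, `c = |φ|`, `ℓ = |y|`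
  have hφ : CodeFP inE (rawE (rawE litE)) (fun p => p.1) :=
    ((map₀ (rawOfList litE)).comp ((rawOfList (listE litE)).comp (fst _ _))).congr fun p => by simp
  have hc : CodeFP inE natE (fun p => p.1.length) := (natOfUn.comp ((ulength _).comp hφ)).congr fun _ => rfl
  have hℓu : CodeFP inE unE (fun p => p.2.length) := strLength.comp (snd _ _)
  -- the parameters `M`, `m`, `k` (unary and binary)
  have hℓ2u : CodeFP inE unE (fun p => p.2.length + 2) := (unSucc.comp (unSucc.comp hℓu)).congr fun _ => rfl
  have hpowu : CodeFP inE unE (fun p => (p.2.length + 2) ^ a) := (AOWProg.powUFP a).comp hℓ2u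
  have hMu : CodeFP inE unE (fun p => MOf a p.2.length) := (unAdd.comp (hpowu.pair hℓu)).congr fun _ => rfl
  have hM : CodeFP inE natE (fun p => MOf a p.2.length) := (natOfUn.comp hMu).congr fun _ => rfl
  have hmu : CodeFP inE unE (fun p => mOf a p.2.length) :=
    (unSucc.comp (unAdd.comp (hMu.pair hMu))).congr fun _ => by unfold mOf; simp only; ring
  have hm : CodeFP inE natE (fun p => mOf a p.2.length) := (natOfUn.comp hmu).congr fun _ => rfl
  have hku : CodeFP inE unE (fun p => kOf (MOf a p.2.length) p.1.length) := (unOfNatMin.comp (hMu.pair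
    (natDiv.comp ((natSub.comp ((natAdd.comp (hM.pair hc)).pair (const _ 1))).pair hc)))).congr fun _ => rfl
  have hk : CodeFP inE natE (fun p => kOf (MOf a p.2.length) p.1.length) := (natOfUn.comp hku).congr fun _ => rfl
  -- the copies and the padding
  have hcop : CodeFP inE (rawE (rawE litE)) (fun p => copies p.1 (kOf (MOf a p.2.length) p.1.length)) :=
    (copiesFP.comp ((hφ.pair hk).pair (urange.comp hku))).congr fun _ => rfl
  have hpn : CodeFP inE natE (fun p => mOf a p.2.length - kOf (MOf a p.2.length) p.1.length * p.1.length) :=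
    (natSub.comp (hm.pair (natMul.comp (hk.pair hc)))).congr fun _ => rfl
  have hpu : CodeFP inE unE (fun p => mOf a p.2.length - kOf (MOf a p.2.length) p.1.length * p.1.length) :=
    (unOfNatMin.comp (hmu.pair hpn)).congr fun _ => min_eq_left (Nat.sub_le _ _)
  have hpad : CodeFP inE (rawE (rawE litE))
      (fun p => (List.range (mOf a p.2.length - kOf (MOf a p.2.length) p.1.length * p.1.length)).map padClause) :=
    ((map₀ padClauseFP).comp (urange.comp hpu)).congr fun _ => rfl
  -- the output, with its length headers
  have hout : CodeFP inE (rawE (rawE litE)) (fun p => dupPad a p.1 p.2.length) :=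
    ((rawAppend (rawE litE)).comp (hcop.pair hpad)).congr fun _ => rfl
  exact ((listOfRaw (listE litE)).comp ((map₀ (listOfRaw litE)).comp hout)).congr fun _ => by simp

end DupPad

/-- **S2b — shape uniformiser: disjoint duplication and padding (a typed `CodeFP` program).** For every
exponent `a` there are `d ∈ FP`, a strictly monotone positive clause-count map `m` and `κ > 0` such that
on `⟨code φ, y⟩` with `φ` an E3-CNF of at most `(|y| + 2)^a` clauses, `d` outputs the code of an E3-CNF
`ψ` with exactly `m |y|` clauses, occurrences bounded by `max B 1` when those of `φ` are bounded by `B`,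
satisfiable if `φ` is, and of value `≤ 1 - κ γ` whenever `val φ ≤ 1 - γ` (`ψ = DupPad.dupPad a φ |y|`, `κ = 1/3`). -/
theorem stub_dupPad : ∀ a : ℕ,
    ∃ (d : List Bool → List Bool) (m : ℕ → ℕ) (κ : ℚ), d ∈ FP ∧ StrictMono m ∧ (∀ k, 0 < m k) ∧ 0 < κ ∧
      ∀ (φ : CNF ℕ) (y : List Bool), φ.IsExactWidth 3 → φ.length ≤ (y.length + 2) ^ a →
        ∃ ψ : CNF ℕ, d (boolPair (encodingCNF.encode φ) y) = encodingCNF.encode ψ ∧ ψ.IsExactWidth 3 ∧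
          ψ.length = m y.length ∧
          (∀ B : ℕ, (∀ v : ℕ, (φ.countP fun cl => v ∈ cl.map Prod.fst) ≤ B) →
            ∀ v : ℕ, (ψ.countP fun cl => v ∈ cl.map Prod.fst) ≤ max B 1) ∧
          (φ.Satisfiable → ψ.Satisfiable) ∧
          (∀ γ : ℚ, φ.maxSatFraction ≤ 1 - γ → ψ.maxSatFraction ≤ 1 - κ * γ) := by
  intro a
  obtain ⟨d, hd, hdF⟩ := DupPad.dupPad_codeFP a
  refine ⟨d, DupPad.mOf a, 1 / 3, hd, DupPad.mOf_strictMono a, DupPad.mOf_pos a, by norm_num, fun φ y h3 hlen => ?_⟩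
  refine ⟨DupPad.dupPad a φ y.length, ?_, DupPad.isExactWidth_dupPad a h3 _, DupPad.length_dupPad a hlen,
    fun B hB v => DupPad.countP_dupPad_le a hB _ v, fun h => DupPad.satisfiable_dupPad a h _,
    fun γ hγ => DupPad.maxSatFraction_dupPad_le a hlen hγ⟩
  rw [AOWProg.cnfE_eq]
  exact hdF (φ, y)

end Summit.PneNP.PneNP.Theorems
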